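import Literature.AlgebraicGeometry.ComplexMultiplication.CyclotomicFermatCMTypesKoblitzListClassNumberInstances
import Literature.AlgebraicGeometry.ComplexMultiplication.CyclotomicFermatCMTypesKoblitzListElevenLevels
import Literature.AlgebraicGeometry.ComplexMultiplication.CyclotomicFermatCMTypesKoblitzListNegOneSquare
import Literature.NumberTheory.LFunctions.BernoulliOneCharOddPrimitiveBound
import HarnessLib

/-!
# Koblitz's list: the mixed prime families `2·pᵏ`, `4·pᵏ`, `3ᵃ·pᵇ` (`p ≡ 3 (mod 4)`) are settled for EVERY prime `p` —
# `|B_{1,χ_p}| ≤ π⁻¹√p·log p` above a threshold, Euler-criterion kernel certificates for `h(−p)` below it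

Layer `Literature/AlgebraicGeometry/ComplexMultiplication`, namespace `…ComplexMultiplication.CyclotomicFermatCMType`; sequel of
`…KoblitzListTwicePrimePowersConditional` / `…ThreeTimesPrimePowersConditional` (gen 43: at the levels `2·pⁿ⁺¹`, `4·pⁿ⁺¹` (`p ≡ 3 (mod 8)`) and
`3ᵐ⁺¹·pⁿ⁺¹` (`p ≡ 7 (mod 12)`) NO primitive normalised triple has `H_{r,s,t}` a group PROVIDED `16·|B_{1,χ_p}| < p − 1`, `8·|B_{1,χ_p}| < p − 1`,
`6·|B_{1,χ_p}| < p − 1` respectively, `|B_{1,χ_p}| = h(−p)`), `…KoblitzListClassNumberInstances` (kernel instances `p ≤ 131`) and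
`Literature/NumberTheory/LFunctions/BernoulliOneCharOddPrimitiveBound` (this lane gen 44: `|B_{1,χ}| ≤ π⁻¹√f·log f` for odd primitive `χ`).
THEOREMS ONLY (no definition, no named fact, no `sorry`).

SOURCE.  M. Bauer, A. Coste, C. Itzykson, P. Ruelle, *J. Geom. Phys.* **22** (1997) §3.4 p. 14 (held: `paper:arxiv-hep-th_9604104`): the list
`{3, 4, 6, 7, 8, 12, 15, 16, 18, 20, 21, 22, 24, 30, 39, 40, 48, 60}` [kob] of the levels `n₀` of the Fermat Jacobian factors isogenous to a power of a
CM elliptic curve ([kob] = N. Koblitz, Duke Math. J. **45** (1978) 87–99, NOT held, acq-13447; the proofs here are ours).  N. Koblitz, D. Rohrlich,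
*Canad. J. Math.* **30** (1978) §2 p. 1187 (the displayed formula for `H_{r,s,t}` a group).  K. Ireland, M. Rosen, *A Classical Introduction to
Modern Number Theory* (Springer GTM 84, 1982; held `book:ireland1982-…`, read at pdf p. 65): Ch. 5 §1 Prop. 5.1.2 (a) (Euler's criterion
`a^{(p−1)/2} ≡ (a/p) (mod p)`).  S. Lang, *Cyclotomic Fields I and II* (1990) Ch. 2 §1 (`B_{1,χ}`).

THE POINT.  The two hypotheses of gen 43's conditional theorems are discharged for EVERY prime: ABOVE a threshold by the analytic bound
`|B_{1,χ_p}| ≤ π⁻¹√p·log p` (`χ_p` is odd and primitive of conductor `p` for `p ≡ 3 (mod 4)`) and the elementary inequalities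
`6·π⁻¹√p·log p < p − 1` (`p ≥ 121`), `8·(…) < p − 1` (`p ≥ 196`), `16·(…) < p − 1` (`p ≥ 1369`) (tangent-line bound `log x ≤ log x₀ + x/x₀ − 1`,
`π > 3.141592`, `log 2 < 0.6931471808`); BELOW it by KERNEL CERTIFICATES for `h(−p)`: `2p·B_{1,χ_p} = Σ_{a<p} χ_p(a)(2a − p)` with `χ_p(a)`
evaluated by EULER'S CRITERION `a^{(p−1)/2} mod p` (fast `Nat.pow`/`Nat.mod` in the kernel — the `quadraticChar` instances of the prequel enumerate
squares and stop near `p ≈ 160`), one `decide` for the `46` primes `p ≡ 3 (mod 8)`, `139 ≤ p ≤ 1307` (`16·h(−p) < p − 1` for all of them) and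
one for `{139, 163, 179}` (`8·h(−p) < p − 1`), with decided coverage lemmas (every other `q ≡ 3 (mod 8)` in range has a factor `≤ 37`).

## What is proved (namespace `…CyclotomicFermatCMType`)

* §1 **`norm_bernoulliOneChar_quadraticChar_le_sqrt_mul_log`** — `p ≡ 3 (mod 4)`: `|B_{1,χ_p}| ≤ π⁻¹·√p·log p`; the thresholds (private)
  and **`six_mul_norm_bernoulliOneChar_lt`** (`p ≥ 121`), **`eight_mul_norm_bernoulliOneChar_lt`** (`p ≥ 196`),
  **`sixteen_mul_norm_bernoulliOneChar_lt`** (`p ≥ 1369`).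
* §2 **`quadraticChar_natCast_eq_ite`** (Euler's criterion, computable form), **`sum_quadraticChar_mul_eq_sum_ite`**,
  **`norm_bernoulliOneChar_quadraticChar_eq_natAbs_div`** (`|B_{1,χ_p}| = |S_p|/(2p)`, `S_p = Σ_{a<p} ε_p(a)(2a − p)`), the certificates
  **`sixteen_mul_natAbs_sum_lt_of_mem`** (46 primes), **`eight_mul_natAbs_sum_lt_of_mem`** (`139, 163, 179`), coverage lemmas, and
  **`sixteen_mul_norm_bernoulliOneChar_lt_of_lt`** (`p ≡ 3 (mod 8)` prime, `139 ≤ p < 1369`), **`eight_mul_norm_bernoulliOneChar_lt_of_lt`**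
  (`139 ≤ p < 196`).
* §3 THE FAMILIES, EVERY PRIME: **`not_forall_mul_mem_threeTimesPrimePow_of_mod_twelve`** (`p ≡ 7 (mod 12)`, `p ≥ 19`: NO primitive group
  triple at any `3ᵐ⁺¹·pⁿ⁺¹`), **`not_forall_mul_mem_threeTimesPrimePow_of_mod_four`** (**every prime `p ≡ 3 (mod 4)`, `p ∉ {3, 7}`**);
  **`not_forall_mul_mem_fourTimesPrimePow_of_mod_eight`** (`p ≡ 3 (mod 8)`, `p ≠ 3`: none at any `4·pⁿ⁺¹`),
  **`not_forall_mul_mem_fourTimesPrimePow_of_mod_four`** (**every prime `p ≡ 3 (mod 4)`, `p ≠ 3`**);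
  **`not_forall_mul_mem_twicePrimePow_of_mod_eight`** (`p ≡ 3 (mod 8)`, `p ∉ {3, 11}`: none at any `2·pⁿ⁺¹`),
  **`not_forall_mul_mem_twicePrimePow_of_ne`** (**every odd prime `p ∉ {3, 11}`**; `p ≡ 1 (mod 4)` by `−1` a square).
  The exceptions are genuine: `6 = 2·3`, `22 = 2·11`, `12 = 4·3`, `21 = 3·7` are printed levels (and `3ᵃ·3ᵇ` is the `3`-smooth family).

## Honest column / NOT here

* `4·pᵏ` and `3ᵃ·pᵇ` with `p ≡ 1 (mod 4)` (printed members `20 = 4·5`, `15 = 3·5`, `39 = 3·13`) are not touched: `χ_p` is then even and the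
  prequels' mechanism does not apply.  The printed list itself remains CITE [kob] beyond the settled families.
* `J(F_n)` is not constructed; statements are about the K–R factor types.  HC_CM is NOT proved and nothing here bears on it.

## References

* [BauerCosteItzyksonRuelle1997] M. Bauer, A. Coste, C. Itzykson, P. Ruelle, J. Geom. Phys. 22 (1997) 134–189, §3.4 (p. 14).
* [KoblitzRohrlich1978] N. Koblitz, D. Rohrlich, Canad. J. Math. 30 (1978) 1183–1205, §2 (p. 1187).
* [IrelandRosen1982] K. Ireland, M. Rosen, A Classical Introduction to Modern Number Theory, GTM 84, Springer 1982, Ch. 5 §1 Prop. 5.1.2.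
* [LangCyclotomic1990] S. Lang, Cyclotomic Fields I and II, GTM 121, Springer 1990, Ch. 2 §1.
* [Oesterle1988Gauss] J. Oesterlé, Le problème de Gauss sur le nombre de classes, Enseign. Math. 34 (1988), II §3.
* [kob] N. Koblitz, Duke Math. J. 45 (1978) 87–99 — cited for the statement of the list only; not held, not used.

## Provenance

Cell `pub-hodgecm2` (COR-CM), literature seat `lit-deligne-3` gen 44 (claim KOBLITZ-PRIME-FAMILIES; count-neutral, own lane).  HC_CM is NOT
proved and nothing here bears on it.
-/

noncomputable section

open NumberField

namespace Literature.AlgebraicGeometry.ComplexMultiplication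

open Literature.NumberTheory.LFunctions
open Literature.AlgebraicGeometry.HodgeTheory (fermatCMType)

namespace CyclotomicFermatCMType

/-! ## §1 The analytic bound `|B_{1,χ_p}| ≤ π⁻¹√p·log p` and the thresholds -/

section Analytic

variable {p : ℕ} [hp : Fact p.Prime]

/-- `χ_p ⊗ ℂ` is primitive for `p ≡ 3 (mod 4)`: its conductor divides the prime `p` and is not `1` (the character is odd, hence non-trivial). [folklore] -/
private theorem isPrimitive_quadraticChar_of_mod_four (hp4 : p % 4 = 3) :
    DirichletCharacter.IsPrimitive ((quadraticChar (ZMod p)).ringHomComp (Int.castRingHom ℂ)) := by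
  set χ : DirichletCharacter ℂ p := (quadraticChar (ZMod p)).ringHomComp (Int.castRingHom ℂ) with hχ
  rw [DirichletCharacter.isPrimitive_def]
  rcases (Nat.dvd_prime hp.out).1 (DirichletCharacter.conductor_dvd_level χ) with h1 | h
  · exact absurd (DirichletCharacter.eq_one_iff_conductor_eq_one.2 h1)
      (OddCharLogDeriv.ne_one_of_odd (hχ ▸ quadraticChar_odd_of_mod_four hp4))
  · exact h

/-- **`|B_{1,χ_p}| ≤ π⁻¹·√p·log p` for a prime `p ≡ 3 (mod 4)`** (`χ_p` odd, primitive of conductor `p`; `|B_{1,χ}| = π⁻¹√f·|L(1, χ̄)|` and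
`|L(1, χ̄)| ≤ log f`). [cite: Oesterle1988Gauss, II §3 Proposition p. 57 (27)] [cite: LangCyclotomic1990, Ch. 2 §1] -/
theorem norm_bernoulliOneChar_quadraticChar_le_sqrt_mul_log (hp4 : p % 4 = 3) :
    ‖bernoulliOneChar ((quadraticChar (ZMod p)).ringHomComp (Int.castRingHom ℂ))‖ ≤ Real.pi⁻¹ * Real.sqrt p * Real.log p :=
  BernoulliOneCharBound.norm_bernoulliOneChar_le_sqrt_mul_log (isPrimitive_quadraticChar_of_mod_four hp4)
    (quadraticChar_odd_of_mod_four hp4) hp.out.one_lt.ne'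

/-- Tangent-line bound for the concave logarithm: `log x ≤ log x₀ + x/x₀ − 1`. [folklore] -/
private theorem log_le_log_add_div_sub_one {x x₀ : ℝ} (hx : 0 < x) (hx₀ : 0 < x₀) :
    Real.log x ≤ Real.log x₀ + x / x₀ - 1 := by
  have h := Real.log_le_sub_one_of_pos (div_pos hx hx₀)
  rw [Real.log_div hx.ne' hx₀.ne'] at h
  linarith

/-- `log 16 < 2.7725888`. [folklore] -/
private theorem log_sixteen_lt : Real.log 16 < 2.7725888 := by
  have h : Real.log 16 = 4 * Real.log 2 := by
    rw [show (16 : ℝ) = 2 ^ 4 by norm_num, Real.log_pow]; norm_num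
  rw [h]; have := Real.log_two_lt_d9; linarith

/-- `log 32 < 3.465736`. [folklore] -/
private theorem log_thirtytwo_lt : Real.log 32 < 3.465736 := by
  have h : Real.log 32 = 5 * Real.log 2 := by
    rw [show (32 : ℝ) = 2 ^ 5 by norm_num, Real.log_pow]; norm_num
  rw [h]; have := Real.log_two_lt_d9; linarith

/-- `12·x·log x < π(x² − 1)` for `x ≥ 11`. [folklore] -/
private theorem twelve_mul_log_lt {x : ℝ} (hx : 11 ≤ x) : 2 * 6 * x * Real.log x < Real.pi * (x ^ 2 - 1) := by
  have hx0 : 0 < x := by linarith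
  have hl := log_le_log_add_div_sub_one hx0 (by norm_num : (0 : ℝ) < 16)
  have h16 := log_sixteen_lt
  have h1 : x * Real.log x ≤ x * (1.7725888 + x / 16) := mul_le_mul_of_nonneg_left (by linarith) hx0.le
  have h2 : 3.141592 * (x ^ 2 - 1) < Real.pi * (x ^ 2 - 1) := mul_lt_mul_of_pos_right Real.pi_gt_d6 (by nlinarith)
  nlinarith [mul_self_nonneg (x - 11)]

/-- `16·x·log x < π(x² − 1)` for `x ≥ 14`. [folklore] -/
private theorem sixteen_mul_log_lt {x : ℝ} (hx : 14 ≤ x) : 2 * 8 * x * Real.log x < Real.pi * (x ^ 2 - 1) := by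
  have hx0 : 0 < x := by linarith
  have hl := log_le_log_add_div_sub_one hx0 (by norm_num : (0 : ℝ) < 16)
  have h16 := log_sixteen_lt
  have h1 : x * Real.log x ≤ x * (1.7725888 + x / 16) := mul_le_mul_of_nonneg_left (by linarith) hx0.le
  have h2 : 3.141592 * (x ^ 2 - 1) < Real.pi * (x ^ 2 - 1) := mul_lt_mul_of_pos_right Real.pi_gt_d6 (by nlinarith)
  nlinarith [mul_self_nonneg (x - 14)]

/-- `32·x·log x < π(x² − 1)` for `x ≥ 37`. [folklore] -/
private theorem thirtytwo_mul_log_lt {x : ℝ} (hx : 37 ≤ x) : 2 * 16 * x * Real.log x < Real.pi * (x ^ 2 - 1) := by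
  have hx0 : 0 < x := by linarith
  have hl := log_le_log_add_div_sub_one hx0 (by norm_num : (0 : ℝ) < 32)
  have h32 := log_thirtytwo_lt
  have h1 : x * Real.log x ≤ x * (2.465736 + x / 32) := mul_le_mul_of_nonneg_left (by linarith) hx0.le
  have h2 : 3.141592 * (x ^ 2 - 1) < Real.pi * (x ^ 2 - 1) := mul_lt_mul_of_pos_right Real.pi_gt_d6 (by nlinarith)
  nlinarith [mul_self_nonneg (x - 37)]

omit hp in
/-- From `2c·x·log x < π(x² − 1)` for `x ≥ X` and `X² ≤ p`: `c·π⁻¹·√p·log p < p − 1`. [folklore] -/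
private theorem mul_sqrt_log_lt_of_sq_le {c X : ℝ} (hX : 0 ≤ X) (hXp : X ^ 2 ≤ (p : ℝ))
    (h : ∀ x : ℝ, X ≤ x → 2 * c * x * Real.log x < Real.pi * (x ^ 2 - 1)) :
    c * (Real.pi⁻¹ * Real.sqrt p * Real.log p) < (p : ℝ) - 1 := by
  have hp0 : (0 : ℝ) ≤ p := Nat.cast_nonneg _
  have hx2 : Real.sqrt p ^ 2 = (p : ℝ) := Real.sq_sqrt hp0
  have hXx : X ≤ Real.sqrt p := by
    rw [← Real.sqrt_sq hX]; exact Real.sqrt_le_sqrt hXp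
  have hlog : Real.log p = 2 * Real.log (Real.sqrt p) := by
    rw [Real.log_sqrt hp0]; ring
  have key := h _ hXx
  rw [hx2] at key
  rw [hlog, show c * (Real.pi⁻¹ * Real.sqrt p * (2 * Real.log (Real.sqrt p))) =
    Real.pi⁻¹ * (2 * c * Real.sqrt p * Real.log (Real.sqrt p)) by ring, inv_mul_lt_iff₀ Real.pi_pos]
  exact key

/-- **`6·|B_{1,χ_p}| < p − 1` for every prime `p ≡ 3 (mod 4)`, `p ≥ 121`.** [cite: Oesterle1988Gauss, II §3 Proposition p. 57 (27)]
[cite: BauerCosteItzyksonRuelle1997, §3.4] -/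
theorem six_mul_norm_bernoulliOneChar_lt (hp4 : p % 4 = 3) (h121 : 121 ≤ p) :
    6 * ‖bernoulliOneChar ((quadraticChar (ZMod p)).ringHomComp (Int.castRingHom ℂ))‖ < (p : ℝ) - 1 :=
  lt_of_le_of_lt (mul_le_mul_of_nonneg_left (norm_bernoulliOneChar_quadraticChar_le_sqrt_mul_log hp4) (by norm_num))
    (mul_sqrt_log_lt_of_sq_le (by norm_num) (by norm_num; exact_mod_cast h121) fun _ hx => twelve_mul_log_lt hx)

/-- **`8·|B_{1,χ_p}| < p − 1` for every prime `p ≡ 3 (mod 4)`, `p ≥ 196`.** [cite: Oesterle1988Gauss, II §3 Proposition p. 57 (27)]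
[cite: BauerCosteItzyksonRuelle1997, §3.4] -/
theorem eight_mul_norm_bernoulliOneChar_lt (hp4 : p % 4 = 3) (h196 : 196 ≤ p) :
    8 * ‖bernoulliOneChar ((quadraticChar (ZMod p)).ringHomComp (Int.castRingHom ℂ))‖ < (p : ℝ) - 1 :=
  lt_of_le_of_lt (mul_le_mul_of_nonneg_left (norm_bernoulliOneChar_quadraticChar_le_sqrt_mul_log hp4) (by norm_num))
    (mul_sqrt_log_lt_of_sq_le (by norm_num) (by norm_num; exact_mod_cast h196) fun _ hx => sixteen_mul_log_lt hx)

/-- **`16·|B_{1,χ_p}| < p − 1` for every prime `p ≡ 3 (mod 4)`, `p ≥ 1369`.** [cite: Oesterle1988Gauss, II §3 Proposition p. 57 (27)]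
[cite: BauerCosteItzyksonRuelle1997, §3.4] -/
theorem sixteen_mul_norm_bernoulliOneChar_lt (hp4 : p % 4 = 3) (h1369 : 1369 ≤ p) :
    16 * ‖bernoulliOneChar ((quadraticChar (ZMod p)).ringHomComp (Int.castRingHom ℂ))‖ < (p : ℝ) - 1 :=
  lt_of_le_of_lt (mul_le_mul_of_nonneg_left (norm_bernoulliOneChar_quadraticChar_le_sqrt_mul_log hp4) (by norm_num))
    (mul_sqrt_log_lt_of_sq_le (by norm_num) (by norm_num; exact_mod_cast h1369) fun _ hx => thirtytwo_mul_log_lt hx)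

end Analytic

/-! ## §2 Euler's criterion and kernel certificates for `h(−p)` below the thresholds -/

section Euler

variable {p : ℕ} [hp : Fact p.Prime]

/-- **Euler's criterion, computable form**: `(a/p) = 0` if `p ∣ a`, else `+1` or `−1` according as `a^{(p−1)/2} ≡ 1 (mod p)` or not
(`p` odd; `p / 2 = (p − 1)/2`). [cite: IrelandRosen1982, Ch. 5 §1 Prop. 5.1.2 (a)] -/
theorem quadraticChar_natCast_eq_ite (hp2 : p ≠ 2) (a : ℕ) :
    (quadraticChar (ZMod p) (a : ZMod p) : ℤ) = if a % p = 0 then 0 else if a ^ (p / 2) % p = 1 then 1 else -1 := by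
  have hF : ringChar (ZMod p) ≠ 2 := by rwa [ZMod.ringChar_zmod_n]
  by_cases ha : a % p = 0
  · rw [if_pos ha, (ZMod.natCast_eq_zero_iff a p).2 (Nat.dvd_of_mod_eq_zero ha), MulChar.map_zero]
  · rw [if_neg ha]
    have ha' : (a : ZMod p) ≠ 0 := fun h => ha (Nat.mod_eq_zero_of_dvd ((ZMod.natCast_eq_zero_iff a p).1 h))
    rw [quadraticChar_eq_pow_of_char_ne_two hF ha', ZMod.card]
    have hiff : (a : ZMod p) ^ (p / 2) = 1 ↔ a ^ (p / 2) % p = 1 := by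
      rw [← Nat.cast_pow, ← Nat.cast_one (R := ZMod p), ZMod.natCast_eq_natCast_iff', Nat.mod_eq_of_lt hp.out.one_lt]
    by_cases h : a ^ (p / 2) % p = 1
    · rw [if_pos h, if_pos (hiff.2 h)]
    · rw [if_neg h, if_neg (mt hiff.1 h)]

/-- `Σ_{a<p} χ_p(a)(2a − p)` computed through Euler's criterion. [cite: IrelandRosen1982, Ch. 5 §1 Prop. 5.1.2 (a)] -/
theorem sum_quadraticChar_mul_eq_sum_ite (hp2 : p ≠ 2) :
    ∑ a ∈ Finset.range p, (quadraticChar (ZMod p) (a : ZMod p) : ℤ) * (2 * (a : ℤ) - p) =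
      ∑ a ∈ Finset.range p, (if a % p = 0 then (0 : ℤ) else if a ^ (p / 2) % p = 1 then 1 else -1) * (2 * (a : ℤ) - p) :=
  Finset.sum_congr rfl fun a _ => by rw [quadraticChar_natCast_eq_ite hp2]

/-- **`|B_{1,χ_p}| = |S_p| / (2p)`** with `S_p = Σ_{a<p} ε_p(a)(2a − p)`, `ε_p` = Euler's criterion sign (so `|B_{1,χ_p}| = h(−p)` is kernel-
computable by modular exponentiation). [cite: LangCyclotomic1990, Ch. 2 §1 (definition of B_{1,χ})] [cite: IrelandRosen1982, Ch. 5 §1 Prop. 5.1.2 (a)] -/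
theorem norm_bernoulliOneChar_quadraticChar_eq_natAbs_div (hp2 : p ≠ 2) :
    ‖bernoulliOneChar ((quadraticChar (ZMod p)).ringHomComp (Int.castRingHom ℂ))‖ =
      ((∑ a ∈ Finset.range p, (if a % p = 0 then (0 : ℤ) else if a ^ (p / 2) % p = 1 then 1 else -1) * (2 * (a : ℤ) - p)).natAbs : ℝ)
        / (2 * p) := by
  have e := two_mul_mul_bernoulliOneChar_quadraticChar_eq_intCast_sum (p := p)
  rw [sum_quadraticChar_mul_eq_sum_ite hp2] at e
  have hpC : (2 * (p : ℂ)) ≠ 0 := mul_ne_zero two_ne_zero (by exact_mod_cast hp.out.ne_zero)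
  have hB : bernoulliOneChar ((quadraticChar (ZMod p)).ringHomComp (Int.castRingHom ℂ)) =
      ((∑ a ∈ Finset.range p, (if a % p = 0 then (0 : ℤ) else if a ^ (p / 2) % p = 1 then 1 else -1) * (2 * (a : ℤ) - p) : ℤ) : ℂ)
        / (2 * p) :=
    eq_div_of_mul_eq hpC (by rw [← e]; ring)
  have h2p : ‖(2 * (p : ℂ))‖ = 2 * p := by
    rw [show (2 * (p : ℂ)) = ((2 * p : ℕ) : ℂ) by push_cast; ring, Complex.norm_natCast]; push_cast; ring
  rw [hB, norm_div, Complex.norm_intCast, h2p, Nat.cast_natAbs, Int.cast_abs]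

/-- **KERNEL CERTIFICATE: `16·h(−p) < p − 1` for the `46` primes `p ≡ 3 (mod 8)`, `139 ≤ p ≤ 1307`** (`h(−p) = |S_p|/(2p)` by Euler's
criterion; one `decide`). [cite: BauerCosteItzyksonRuelle1997, §3.4] [cite: IrelandRosen1982, Ch. 5 §1 Prop. 5.1.2 (a)] -/
theorem sixteen_mul_natAbs_sum_lt_of_mem : ∀ q ∈ ([139, 163, 179, 211, 227, 251, 283, 307, 331, 347, 379, 419, 443, 467, 491, 499, 523,
      547, 563, 571, 587, 619, 643, 659, 683, 691, 739, 787, 811, 827, 859, 883, 907, 947, 971, 1019, 1051, 1091, 1123, 1163, 1171, 1187, 1259,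
      1283, 1291, 1307] : List ℕ),
    16 * (∑ a ∈ Finset.range q, (if a % q = 0 then (0 : ℤ) else if a ^ (q / 2) % q = 1 then 1 else -1) * (2 * (a : ℤ) - q)).natAbs
      < 2 * q * (q - 1) := by
  decide +kernel

/-- **KERNEL CERTIFICATE: `8·h(−p) < p − 1` for `p ∈ {139, 163, 179}`** (`h = 3, 1, 5`). [cite: BauerCosteItzyksonRuelle1997, §3.4]
[cite: IrelandRosen1982, Ch. 5 §1 Prop. 5.1.2 (a)] -/
theorem eight_mul_natAbs_sum_lt_of_mem : ∀ q ∈ ([139, 163, 179] : List ℕ),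
    8 * (∑ a ∈ Finset.range q, (if a % q = 0 then (0 : ℤ) else if a ^ (q / 2) % q = 1 then 1 else -1) * (2 * (a : ℤ) - q)).natAbs
      < 2 * q * (q - 1) := by
  decide +kernel

/-- Coverage: every `q ≡ 3 (mod 8)` with `139 ≤ q < 1369` is one of the `46` listed primes or has a prime factor `≤ 37`. [cite:
BauerCosteItzyksonRuelle1997, §3.4] -/
theorem mem_or_exists_dvd_of_lt_1369 : ∀ q ∈ Finset.range 1369, 139 ≤ q → q % 8 = 3 →
    q ∈ ([139, 163, 179, 211, 227, 251, 283, 307, 331, 347, 379, 419, 443, 467, 491, 499, 523, 547, 563, 571, 587, 619, 643, 659, 683, 691,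
      739, 787, 811, 827, 859, 883, 907, 947, 971, 1019, 1051, 1091, 1123, 1163, 1171, 1187, 1259, 1283, 1291, 1307] : List ℕ) ∨
      ∃ d ∈ ([3, 5, 7, 11, 13, 17, 19, 23, 29, 31, 37] : List ℕ), d ∣ q := by
  decide +kernel

/-- Coverage: every `q ≡ 3 (mod 8)` with `139 ≤ q < 196` is `139, 163, 179` or has a prime factor `≤ 13`. [cite: BauerCosteItzyksonRuelle1997, §3.4] -/
theorem mem_or_exists_dvd_of_lt_196 : ∀ q ∈ Finset.range 196, 139 ≤ q → q % 8 = 3 →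
    q ∈ ([139, 163, 179] : List ℕ) ∨ ∃ d ∈ ([3, 5, 7, 11, 13] : List ℕ), d ∣ q := by
  decide +kernel

/-- Coverage: every `q ≡ 3 (mod 8)` with `19 ≤ q < 139` is `19, 43, 59, 67, 83, 107, 131` or has a prime factor `≤ 11`.
[cite: BauerCosteItzyksonRuelle1997, §3.4] -/
theorem mem_or_exists_dvd_of_lt_139 : ∀ q ∈ Finset.range 139, 19 ≤ q → q % 8 = 3 →
    q ∈ ([19, 43, 59, 67, 83, 107, 131] : List ℕ) ∨ ∃ d ∈ ([3, 5, 7, 11] : List ℕ), d ∣ q := by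
  decide +kernel

/-- Coverage: every `q ≡ 7 (mod 12)` with `19 ≤ q < 121` is `19, 31, 43, 67, 79, 103` or has a prime factor `≤ 7`.
[cite: BauerCosteItzyksonRuelle1997, §3.4] -/
theorem mem_or_exists_dvd_of_lt_121 : ∀ q ∈ Finset.range 121, 19 ≤ q → q % 12 = 7 →
    q ∈ ([19, 31, 43, 67, 79, 103] : List ℕ) ∨ ∃ d ∈ ([5, 7] : List ℕ), d ∣ q := by
  decide +kernel

/-- Casting a certificate `c·A < 2p(p − 1)` to `c·(A/(2p)) < p − 1` over `ℝ`. [folklore] -/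
private theorem cast_mul_div_lt {c A : ℕ} (hc : c * A < 2 * p * (p - 1)) : (c : ℝ) * ((A : ℝ) / (2 * (p : ℝ))) < (p : ℝ) - 1 := by
  have hp0 : (0 : ℝ) < 2 * p := by have := hp.out.pos; positivity
  rw [mul_div_assoc', div_lt_iff₀ hp0]
  have h2 : ((c * A : ℕ) : ℝ) < ((2 * p * (p - 1) : ℕ) : ℝ) := by exact_mod_cast hc
  push_cast [Nat.cast_sub hp.out.one_le] at h2
  linarith

/-- A prime has no proper divisor from a list of small numbers `2 ≤ d < p`. [folklore] -/
private theorem not_exists_dvd_of_prime {l : List ℕ} (hl : ∀ d ∈ l, 2 ≤ d ∧ d < p) : ¬∃ d ∈ l, d ∣ p := by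
  rintro ⟨d, hd, hdp⟩
  rcases hp.out.eq_one_or_self_of_dvd d hdp with h | h <;> have := hl d hd <;> omega

/-- **`16·|B_{1,χ_p}| < p − 1` for every prime `p ≡ 3 (mod 8)` with `139 ≤ p < 1369`** (kernel certificate). [cite: BauerCosteItzyksonRuelle1997, §3.4]
[cite: LangCyclotomic1990, Ch. 2 §1] -/
theorem sixteen_mul_norm_bernoulliOneChar_lt_of_lt (hp8 : p % 8 = 3) (h139 : 139 ≤ p) (h1369 : p < 1369) :
    16 * ‖bernoulliOneChar ((quadraticChar (ZMod p)).ringHomComp (Int.castRingHom ℂ))‖ < (p : ℝ) - 1 := by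
  have hmem := (mem_or_exists_dvd_of_lt_1369 p (Finset.mem_range.2 h1369) h139 hp8).resolve_right
    (not_exists_dvd_of_prime fun d hd => by simp only [List.mem_cons, List.mem_nil_iff, or_false] at hd; omega)
  have hc := cast_mul_div_lt (sixteen_mul_natAbs_sum_lt_of_mem p hmem)
  rw [norm_bernoulliOneChar_quadraticChar_eq_natAbs_div (by omega)]
  exact_mod_cast hc

/-- **`8·|B_{1,χ_p}| < p − 1` for every prime `p ≡ 3 (mod 8)` with `139 ≤ p < 196`** (kernel certificate). [cite: BauerCosteItzyksonRuelle1997, §3.4]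
[cite: LangCyclotomic1990, Ch. 2 §1] -/
theorem eight_mul_norm_bernoulliOneChar_lt_of_lt (hp8 : p % 8 = 3) (h139 : 139 ≤ p) (h196 : p < 196) :
    8 * ‖bernoulliOneChar ((quadraticChar (ZMod p)).ringHomComp (Int.castRingHom ℂ))‖ < (p : ℝ) - 1 := by
  have hmem := (mem_or_exists_dvd_of_lt_196 p (Finset.mem_range.2 h196) h139 hp8).resolve_right
    (not_exists_dvd_of_prime fun d hd => by simp only [List.mem_cons, List.mem_nil_iff, or_false] at hd; omega)
  have hc := cast_mul_div_lt (eight_mul_natAbs_sum_lt_of_mem p hmem)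
  rw [norm_bernoulliOneChar_quadraticChar_eq_natAbs_div (by omega)]
  exact_mod_cast hc

end Euler

/-! ## §3 The families `3ᵃ·pᵇ`, `4·pᵏ`, `2·pᵏ` for every prime `p ≡ 3 (mod 4)` -/

section Families

variable {p : ℕ} [hp : Fact p.Prime] {m n : ℕ} {N : ℕ} [NeZero N]

/-- **LEVELS `3ᵐ⁺¹·pⁿ⁺¹`, `p ≡ 7 (mod 12)`, `p ≥ 19`: NO primitive normalised triple has `H_{r,s,t}` a group** (`6·h(−p) < p − 1`: kernel
instances `19, 31, 43, 67, 79, 103`, analytic bound from `121` on). [cite: BauerCosteItzyksonRuelle1997, §3.4] [cite: KoblitzRohrlich1978, §2 (p. 1187)] -/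
theorem not_forall_mul_mem_threeTimesPrimePow_of_mod_twelve (hp12 : p % 12 = 7) (h19 : 19 ≤ p) (hN : N = 3 ^ (m + 1) * p ^ (n + 1))
    {r s : ZMod N} (hr : r ≠ 0) (hs : s ≠ 0) (hrs : r.val + s.val < N) (hprim : Nat.gcd (Nat.gcd r.val s.val) N = 1) :
    ¬∀ a ∈ fermatCMType N r s (-(r + s)), ∀ b ∈ fermatCMType N r s (-(r + s)), a * b ∈ fermatCMType N r s (-(r + s)) := by
  by_cases h121 : 121 ≤ p
  · exact not_forall_mul_mem_threeTimesPrimePow_of_bernoulli_lt hp12 (six_mul_norm_bernoulliOneChar_lt (by omega) h121) hN hr hs hrs hprim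
  have hmem := (mem_or_exists_dvd_of_lt_121 p (Finset.mem_range.2 (by omega)) h19 hp12).resolve_right
    (not_exists_dvd_of_prime fun d hd => by simp only [List.mem_cons, List.mem_nil_iff, or_false] at hd; omega)
  simp only [List.mem_cons, List.mem_nil_iff, or_false] at hmem
  rcases hmem with rfl | rfl | rfl | rfl | rfl | rfl
  · exact not_forall_mul_mem_threeTimesNineteenPow hN hr hs hrs hprim
  · exact not_forall_mul_mem_threeTimesPrimePow_p31 hN hr hs hrs hprim
  · exact not_forall_mul_mem_threeTimesPrimePow_p43 hN hr hs hrs hprim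
  · exact not_forall_mul_mem_threeTimesPrimePow_p67 hN hr hs hrs hprim
  · exact not_forall_mul_mem_threeTimesPrimePow_p79 hN hr hs hrs hprim
  · exact not_forall_mul_mem_threeTimesPrimePow_p103 hN hr hs hrs hprim

/-- **LEVELS `3ᵐ⁺¹·pⁿ⁺¹` FOR EVERY PRIME `p ≡ 3 (mod 4)`, `p ∉ {3, 7}`: NO primitive normalised triple has `H_{r,s,t}` a group**
(`p ≡ 11 (mod 12)`: the prequel; `p ≡ 7 (mod 12)`: the previous theorem; `21 = 3·7` IS a printed level). [cite: BauerCosteItzyksonRuelle1997, §3.4]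
[cite: KoblitzRohrlich1978, §2 (p. 1187)] -/
theorem not_forall_mul_mem_threeTimesPrimePow_of_mod_four (hp4 : p % 4 = 3) (hp3 : p ≠ 3) (hp7 : p ≠ 7)
    (hN : N = 3 ^ (m + 1) * p ^ (n + 1)) {r s : ZMod N} (hr : r ≠ 0) (hs : s ≠ 0) (hrs : r.val + s.val < N)
    (hprim : Nat.gcd (Nat.gcd r.val s.val) N = 1) :
    ¬∀ a ∈ fermatCMType N r s (-(r + s)), ∀ b ∈ fermatCMType N r s (-(r + s)), a * b ∈ fermatCMType N r s (-(r + s)) := by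
  rcases (by omega : p % 12 = 3 ∨ p % 12 = 7 ∨ p % 12 = 11) with h | h | h
  · exfalso
    rcases hp.out.eq_one_or_self_of_dvd 3 (by omega) with h' | h' <;> omega
  · exact not_forall_mul_mem_threeTimesPrimePow_of_mod_twelve h (by omega) hN hr hs hrs hprim
  · exact not_forall_mul_mem_threeTimesPrimePow h hN hr hs hrs hprim

/-- **LEVELS `4·pⁿ⁺¹`, `p ≡ 3 (mod 8)`, `p ≠ 3`: NO primitive normalised triple has `H_{r,s,t}` a group** (`p = 11`: the level-`44` theorem;
`8·h(−p) < p − 1`: kernel instances `19, …, 131`, certificates `139, 163, 179`, analytic bound from `196` on; `12 = 4·3` IS printed).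
[cite: BauerCosteItzyksonRuelle1997, §3.4] [cite: KoblitzRohrlich1978, §2 (p. 1187)] -/
theorem not_forall_mul_mem_fourTimesPrimePow_of_mod_eight (hp8 : p % 8 = 3) (hp3 : p ≠ 3) (hN : N = 4 * p ^ (n + 1))
    {r s : ZMod N} (hr : r ≠ 0) (hs : s ≠ 0) (hrs : r.val + s.val < N) (hprim : Nat.gcd (Nat.gcd r.val s.val) N = 1) :
    ¬∀ a ∈ fermatCMType N r s (-(r + s)), ∀ b ∈ fermatCMType N r s (-(r + s)), a * b ∈ fermatCMType N r s (-(r + s)) := by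
  by_cases h196 : 196 ≤ p
  · exact not_forall_mul_mem_fourTimesPrimePow_of_bernoulli_lt hp8 hp3 (eight_mul_norm_bernoulliOneChar_lt (by omega) h196)
      hN hr hs hrs hprim
  by_cases h139 : 139 ≤ p
  · exact not_forall_mul_mem_fourTimesPrimePow_of_bernoulli_lt hp8 hp3 (eight_mul_norm_bernoulliOneChar_lt_of_lt hp8 h139 (by omega))
      hN hr hs hrs hprim
  by_cases h19 : 19 ≤ p
  · have hmem := (mem_or_exists_dvd_of_lt_139 p (Finset.mem_range.2 (by omega)) h19 hp8).resolve_right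
      (not_exists_dvd_of_prime fun d hd => by simp only [List.mem_cons, List.mem_nil_iff, or_false] at hd; omega)
    simp only [List.mem_cons, List.mem_nil_iff, or_false] at hmem
    rcases hmem with rfl | rfl | rfl | rfl | rfl | rfl | rfl
    · exact not_forall_mul_mem_fourTimesNineteenPow hN hr hs hrs hprim
    · exact not_forall_mul_mem_fourTimesPrimePow_p43 hN hr hs hrs hprim
    · exact not_forall_mul_mem_fourTimesPrimePow_p59 hN hr hs hrs hprim
    · exact not_forall_mul_mem_fourTimesPrimePow_p67 hN hr hs hrs hprim
    · exact not_forall_mul_mem_fourTimesPrimePow_p83 hN hr hs hrs hprim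
    · exact not_forall_mul_mem_fourTimesPrimePow_p107 hN hr hs hrs hprim
    · exact not_forall_mul_mem_fourTimesPrimePow_p131 hN hr hs hrs hprim
  · have h11 : p = 11 := by omega
    subst h11
    exact not_forall_mul_mem_fourTimesElevenPow hN hr hs hrs hprim

/-- **LEVELS `4·pⁿ⁺¹` FOR EVERY PRIME `p ≡ 3 (mod 4)`, `p ≠ 3`: NO primitive normalised triple has `H_{r,s,t}` a group** (`p ≡ 7 (mod 8)`:
the prequel; `p ≡ 3 (mod 8)`: the previous theorem). [cite: BauerCosteItzyksonRuelle1997, §3.4] [cite: KoblitzRohrlich1978, §2 (p. 1187)] -/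
theorem not_forall_mul_mem_fourTimesPrimePow_of_mod_four (hp4 : p % 4 = 3) (hp3 : p ≠ 3) (hN : N = 4 * p ^ (n + 1)) {r s : ZMod N}
    (hr : r ≠ 0) (hs : s ≠ 0) (hrs : r.val + s.val < N) (hprim : Nat.gcd (Nat.gcd r.val s.val) N = 1) :
    ¬∀ a ∈ fermatCMType N r s (-(r + s)), ∀ b ∈ fermatCMType N r s (-(r + s)), a * b ∈ fermatCMType N r s (-(r + s)) := by
  rcases (by omega : p % 8 = 3 ∨ p % 8 = 7) with h | h
  · exact not_forall_mul_mem_fourTimesPrimePow_of_mod_eight h hp3 hN hr hs hrs hprim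
  · exact not_forall_mul_mem_fourTimesPrimePow h hN hr hs hrs hprim

/-- **LEVELS `2·pⁿ⁺¹`, `p ≡ 3 (mod 8)`, `p ∉ {3, 11}`: NO primitive normalised triple has `H_{r,s,t}` a group** (`16·h(−p) < p − 1`: kernel
instances `19, …, 131`, certificates for the `46` primes `139 ≤ p ≤ 1307`, analytic bound from `1369` on; `6 = 2·3` and `22 = 2·11` ARE printed).
[cite: BauerCosteItzyksonRuelle1997, §3.4] [cite: KoblitzRohrlich1978, §2 (p. 1187)] -/
theorem not_forall_mul_mem_twicePrimePow_of_mod_eight (hp8 : p % 8 = 3) (hp3 : p ≠ 3) (hp11 : p ≠ 11) (hN : N = 2 * p ^ (n + 1))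
    {r s : ZMod N} (hr : r ≠ 0) (hs : s ≠ 0) (hrs : r.val + s.val < N) (hprim : Nat.gcd (Nat.gcd r.val s.val) N = 1) :
    ¬∀ a ∈ fermatCMType N r s (-(r + s)), ∀ b ∈ fermatCMType N r s (-(r + s)), a * b ∈ fermatCMType N r s (-(r + s)) := by
  by_cases h1369 : 1369 ≤ p
  · exact not_forall_mul_mem_twicePrimePow_of_bernoulli_lt hp8 (sixteen_mul_norm_bernoulliOneChar_lt (by omega) h1369) hN hr hs hrs hprim
  by_cases h139 : 139 ≤ p
  · exact not_forall_mul_mem_twicePrimePow_of_bernoulli_lt hp8 (sixteen_mul_norm_bernoulliOneChar_lt_of_lt hp8 h139 (by omega))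
      hN hr hs hrs hprim
  have h19 : 19 ≤ p := by omega
  have hmem := (mem_or_exists_dvd_of_lt_139 p (Finset.mem_range.2 (by omega)) h19 hp8).resolve_right
    (not_exists_dvd_of_prime fun d hd => by simp only [List.mem_cons, List.mem_nil_iff, or_false] at hd; omega)
  simp only [List.mem_cons, List.mem_nil_iff, or_false] at hmem
  rcases hmem with rfl | rfl | rfl | rfl | rfl | rfl | rfl
  · exact not_forall_mul_mem_twiceNineteenPow hN hr hs hrs hprim
  · exact not_forall_mul_mem_twicePrimePow_p43 hN hr hs hrs hprim
  · exact not_forall_mul_mem_twicePrimePow_p59 hN hr hs hrs hprim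
  · exact not_forall_mul_mem_twicePrimePow_p67 hN hr hs hrs hprim
  · exact not_forall_mul_mem_twicePrimePow_p83 hN hr hs hrs hprim
  · exact not_forall_mul_mem_twicePrimePow_p107 hN hr hs hrs hprim
  · exact not_forall_mul_mem_twicePrimePow_p131 hN hr hs hrs hprim

/-- **LEVELS `2·pⁿ⁺¹` FOR EVERY ODD PRIME `p ∉ {3, 11}`: NO primitive normalised triple has `H_{r,s,t}` a group** (`p ≡ 1 (mod 4)`: `−1` is a
square modulo `2·pⁿ⁺¹`; `p ≡ 7 (mod 8)`: the prequel; `p ≡ 3 (mod 8)`: the previous theorem; at `14 = 2·7` only imprimitive triples occur).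
[cite: BauerCosteItzyksonRuelle1997, §3.4] [cite: KoblitzRohrlich1978, §1 (p. 1184), §2 (p. 1187)] -/
theorem not_forall_mul_mem_twicePrimePow_of_ne (hp2 : p ≠ 2) (hp3 : p ≠ 3) (hp11 : p ≠ 11) (hN : N = 2 * p ^ (n + 1)) {r s : ZMod N}
    (hr : r ≠ 0) (hs : s ≠ 0) (hrs : r.val + s.val < N) (hprim : Nat.gcd (Nat.gcd r.val s.val) N = 1) :
    ¬∀ a ∈ fermatCMType N r s (-(r + s)), ∀ b ∈ fermatCMType N r s (-(r + s)), a * b ∈ fermatCMType N r s (-(r + s)) := by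
  have hodd : p % 2 = 1 := Nat.odd_iff.1 (hp.out.odd_of_ne_two hp2)
  rcases (by omega : p % 8 = 3 ∨ p % 8 = 7 ∨ p % 4 = 1) with h | h | h
  · exact not_forall_mul_mem_twicePrimePow_of_mod_eight h hp3 hp11 hN hr hs hrs hprim
  · exact not_forall_mul_mem_twicePrimePow h hN hr hs hrs hprim
  · refine not_forall_mul_mem_of_primeFactors_mod_four ?_ ?_ hr hs hrs
    · rw [hN]; intro h4
      have h2 : 2 ∣ p ^ (n + 1) := by omega
      have := (Nat.dvd_prime hp.out).1 (Nat.prime_two.dvd_of_dvd_pow h2); omega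
    · rw [hN]; intro q hq hqN
      rcases (Nat.Prime.dvd_mul hq).1 hqN with h2 | hq'
      · exact Or.inl ((Nat.prime_dvd_prime_iff_eq hq Nat.prime_two).1 h2)
      · right; rw [(Nat.prime_dvd_prime_iff_eq hq hp.out).1 (hq.dvd_of_dvd_pow hq')]; exact h

end Families

end CyclotomicFermatCMType

end Literature.AlgebraicGeometry.ComplexMultiplication
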